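import Summits.QuantumFields.QCD.Theses.WilsonQuarkChessboard
import Summits.QuantumFields.QCD.Theses.RenormalisedVafaWitten
import Summits.QuantumFields.QCD.Theses.GradientFlowSpecies
import Literature.MathematicalPhysics.QuantumFieldTheory.MassGapToLatticeClustering

/-!
# Crux `WilsonQuarkChessboard.MassiveBridge` (stmt-QuantumFields-17577) from the shared laws — the line
`registered` (gen 2) summarised BY NAME (helper file, `--supports`)

The gen-2 skeleton `Cruxes/MassiveBridge/Lines/birth.lean` composes the crux

  `MassiveBridge : QuarkChessboard → FlatCellOptimal → (threshold-massive QCD for N_f = 2, 3)`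

from three laws, and the landed reductions of this line identify them with shared items of the sub-problem:
the UV stub is `FlatCellOptimal → RenormalisedVafaWitten.DynamicalQuarkContinuum` (stmt-QuantumFields-8695; C is
proved and idle — `Theorems/WilsonQuarkChessboardMassiveBridgeStubDominationUV.lean`), the lattice gap law is
`GradientFlowSpecies.MassiveLatticeGap` (stmt-QuantumFields-8922 —
`Theorems/WilsonQuarkChessboardMassiveBridgeStubLatticeGapLaw.lean`), and the species clustering law has the
offset-free normal form used below (`Theorems/WilsonQuarkChessboardMassiveBridgeStubSpeciesClusteringLaw.lean`).
This file proves the composition directly over those NAMED statements, so that the tree records, kernel-checked: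

* `massiveBridge_of_sharedLaws` —
  `(FlatCellOptimal → DynamicalQuarkContinuum) → MassiveLatticeGap → (species clustering law, offset-free) → MassiveBridge`;
* `massiveBridge_of_dynamicalQuarkContinuum_massiveLatticeGap_gapTransfer` —
  `(FlatCellOptimal → DynamicalQuarkContinuum) → MassiveLatticeGap → GapTransfer → MassiveBridge`
  (the GradientFlowSpecies route's open items 8695-shape / 8922 / 8923 close this crux, K idle);
* `massiveBridge_of_items` — the ledger-facing form `DynamicalQuarkContinuum → MassiveLatticeGap → GapTransfer →
  MassiveBridge` (conditional on the three filed items 8695, 8922, 8923; C and K idle).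

Mechanism of the composition: the UV item gives ONE regularisation with offset-free full continuum data; 8922
gives a threshold `M` and a lattice rate `Δ₁` above it; the clustering law a threshold `M₂` and, at the data's
own `(z, shift, T)`, a species rate `Δ₂`, transferred to `T.HasMassGap Δ₂` by the Literature theorem
`IsQCDAlong.hasMassGap_of_hasSpeciesCSClustering`; the crux's offset is `max (max M 0) M₂` and its common rate
`min Δ₁ Δ₂` (both clauses are antitone in the rate).  The species clustering law is the ONLY ingredient that is
not already a filed item; it is implied by 8922 ∧ 8923 (second theorem's route) and is the honest replacement
of 8923's role.  References: Jaffe–Witten 2000 §5; Osterwalder–Seiler 1978 §§2–4; Glimm–Jaffe 1987 §6.1.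
-/

noncomputable section

namespace Summit.QuantumFields.QCD.Theorems

open Literature.MathematicalPhysics.QuantumFieldTheory
open Summit.QuantumFields.QCD.Theses

/-- The uniform lattice gap clause is antitone in the rate (constant `max C 0`). [folklore] -/
private theorem mbsl_hasLatticeMassGap_mono {Nf : ℕ} (sch : QCDScheme Nf) {Δ Δ' : ℝ}
    (h : sch.HasLatticeMassGap Δ) (hle : Δ' ≤ Δ) : sch.HasLatticeMassGap Δ' := by
  intro R R' A B
  obtain ⟨C, hC⟩ := h R R' A B
  refine ⟨max C 0, ?_⟩
  filter_upwards [hC] with k hk S hS n hn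
  have h1 := hk S hS n hn
  have han : 0 ≤ sch.a k * (n : ℝ) := mul_nonneg (sch.a_pos k).le (Nat.cast_nonneg n)
  have hexp : Real.exp (-(Δ * (sch.a k * n))) ≤ Real.exp (-(Δ' * (sch.a k * n))) :=
    Real.exp_le_exp.2 (by nlinarith)
  exact h1.trans ((mul_le_mul_of_nonneg_right (le_max_left C 0) (Real.exp_pos _).le).trans
    (mul_le_mul_of_nonneg_left hexp (le_max_right C 0)))

/-- The continuum gap clause is antitone in the rate (constant `max C 0`). [folklore] -/
private theorem mbsl_hasMassGap_anti {Nf : ℕ} (T : OSData (QCDField Nf) 4) {Δ Δ' : ℝ}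
    (h : T.HasMassGap Δ) (hle : Δ' ≤ Δ) : T.HasMassGap Δ' := by
  intro n m k k' F G hF hG
  obtain ⟨C, hC⟩ := h n m k k' F G hF hG
  refine ⟨max C 0, fun t ht H hH => ?_⟩
  have h1 := hC t ht H hH
  have hexp : Real.exp (-Δ * t) ≤ Real.exp (-Δ' * t) := Real.exp_le_exp.2 (by nlinarith)
  exact h1.trans ((mul_le_mul_of_nonneg_right (le_max_left C 0) (Real.exp_pos _).le).trans
    (mul_le_mul_of_nonneg_left hexp (le_max_right C 0)))

/-- **MassiveBridge from the shared laws.**  The crux `WilsonQuarkChessboard.MassiveBridge` follows from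
(i) the shared UV half modulo the flat-cell optimum, `FlatCellOptimal → RenormalisedVafaWitten.DynamicalQuarkContinuum`
(stmt-QuantumFields-8695), (ii) the shared lattice gap law `GradientFlowSpecies.MassiveLatticeGap`
(stmt-QuantumFields-8922), and (iii) the species clustering law in offset-free form: for `N_f ∈ {2,3}` and every
regularisation with `HasMassScaling` and offset-free full continuum data there is `M₂ ≥ 0` above which every
data-carrying `(z, shift, T)` has species Cauchy–Schwarz clustering at some rate `Δ > 0`.  The quark chessboard
hypothesis is idle. [cite: JaffeWitten2000, §5] [cite: OsterwalderSeiler1978, §§2–4] -/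
theorem massiveBridge_of_sharedLaws
    (hUV : WilsonQuarkChessboard.FlatCellOptimal → RenormalisedVafaWitten.DynamicalQuarkContinuum)
    (hL : GradientFlowSpecies.MassiveLatticeGap)
    (hS : ∀ Nf : ℕ, Nf = 2 ∨ Nf = 3 → ∀ reg : QCDRegularisation Nf, reg.HasMassScaling →
      (∀ m : Fin Nf → ℝ, (∀ f, 0 < m f) →
        ∃ (z shift : QCDField Nf → ℕ → ℝ) (T : OSData (QCDField Nf) 4),
          IsQCDAlong (reg.scheme m z shift) T ∧ T.IsNontrivial QCDField.glue ∧
            T.IsNonGaussian QCDField.glue ∧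
              ∀ f g : Fin Nf, f ≠ g → T.IsNontrivial (QCDField.pseudoRe f g)) →
      ∃ M₂ : ℝ, 0 ≤ M₂ ∧ ∀ m : Fin Nf → ℝ, (∀ f, M₂ < m f) →
        ∀ (z shift : QCDField Nf → ℕ → ℝ) (T : OSData (QCDField Nf) 4),
          IsQCDAlong (reg.scheme m z shift) T →
            ∃ Δ : ℝ, 0 < Δ ∧ (reg.scheme m z shift).HasSpeciesCSClustering Δ) :
    WilsonQuarkChessboard.MassiveBridge := by
  unfold WilsonQuarkChessboard.MassiveBridge
  intro _hC hK Nf hNf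
  obtain ⟨reg, hms, hdata⟩ := hUV hK Nf hNf
  obtain ⟨M, hM⟩ := hL Nf hNf reg ⟨hms, hdata⟩
  obtain ⟨M₂, hM₂, hcs⟩ := hS Nf hNf reg hms hdata
  refine ⟨max (max M 0) M₂, (le_max_right M 0).trans (le_max_left _ _), reg, hms, fun m hm => ?_⟩
  have hmM : ∀ f, M < m f := fun f => ((le_max_left M 0).trans (le_max_left _ _)).trans_lt (hm f)
  have hm0 : ∀ f, 0 < m f := fun f => ((le_max_right M 0).trans (le_max_left _ _)).trans_lt (hm f)
  have hm2 : ∀ f, M₂ < m f := fun f => (le_max_right _ _).trans_lt (hm f)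
  obtain ⟨z, shift, T, hqcd, hglue, hng, hps⟩ := hdata m hm0
  obtain ⟨Δ₁, hΔ₁, hlat⟩ := hM m hmM
  obtain ⟨Δ₂, hΔ₂, hclus⟩ := hcs m hm2 z shift T hqcd
  have hlat' : (reg.scheme m z shift).HasLatticeMassGap Δ₁ := hlat
  have hTgap : T.HasMassGap Δ₂ := hqcd.hasMassGap_of_hasSpeciesCSClustering hclus
  exact ⟨z, shift, T, hqcd, hglue, hng, hps, min Δ₁ Δ₂, lt_min hΔ₁ hΔ₂,
    mbsl_hasMassGap_anti T hTgap (min_le_right _ _), mbsl_hasLatticeMassGap_mono _ hlat' (min_le_left _ _)⟩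

/-- **MassiveBridge from the GradientFlowSpecies route's open items.**  With the shared transfer item
`GradientFlowSpecies.GapTransfer` (stmt-QuantumFields-8923, as typed) in place of the species clustering law:
`(FlatCellOptimal → DynamicalQuarkContinuum) → MassiveLatticeGap → GapTransfer → MassiveBridge` — the lattice rate
`Δ` above 8922's threshold is transferred to `T.HasMassGap (Δ/2)` and both clauses are read at `Δ/2`.
[cite: JaffeWitten2000, §5] [cite: GlimmJaffe1987, §6.1 Thm. 6.1.3] -/
theorem massiveBridge_of_dynamicalQuarkContinuum_massiveLatticeGap_gapTransfer
    (hUV : WilsonQuarkChessboard.FlatCellOptimal → RenormalisedVafaWitten.DynamicalQuarkContinuum)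
    (hL : GradientFlowSpecies.MassiveLatticeGap) (hGT : GradientFlowSpecies.GapTransfer) :
    WilsonQuarkChessboard.MassiveBridge := by
  unfold WilsonQuarkChessboard.MassiveBridge
  intro _hC hK Nf hNf
  obtain ⟨reg, hms, hdata⟩ := hUV hK Nf hNf
  obtain ⟨M, hM⟩ := hL Nf hNf reg ⟨hms, hdata⟩
  refine ⟨max M 0, le_max_right M 0, reg, hms, fun m hm => ?_⟩
  have hmM : ∀ f, M < m f := fun f => (le_max_left M 0).trans_lt (hm f)
  have hm0 : ∀ f, 0 < m f := fun f => (le_max_right M 0).trans_lt (hm f)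
  obtain ⟨z, shift, T, hqcd, hglue, hng, hps⟩ := hdata m hm0
  obtain ⟨Δ, hΔ, hlat⟩ := hM m hmM
  have hlat' : (reg.scheme m z shift).HasLatticeMassGap Δ := hlat
  have hTgap : T.HasMassGap (Δ / 2) :=
    hGT Nf (reg.scheme m z shift) T Δ (Δ / 2) (by positivity) (by linarith) hqcd hlat'
  exact ⟨z, shift, T, hqcd, hglue, hng, hps, Δ / 2, by positivity, hTgap,
    mbsl_hasLatticeMassGap_mono _ hlat' (by linarith)⟩

/-- **MassiveBridge is conditional on three filed items** (the ledger-facing form): the shared UV half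
`RenormalisedVafaWitten.DynamicalQuarkContinuum` (stmt-QuantumFields-8695), the shared lattice gap law
`GradientFlowSpecies.MassiveLatticeGap` (stmt-QuantumFields-8922) and the shared transfer
`GradientFlowSpecies.GapTransfer` (stmt-QuantumFields-8923) together give the crux, both chessboard hypotheses
idle. [cite: JaffeWitten2000, §5] -/
theorem massiveBridge_of_items :
    Summit.QuantumFields.QCD.Theses.RenormalisedVafaWitten.DynamicalQuarkContinuum →
      Summit.QuantumFields.QCD.Theses.GradientFlowSpecies.MassiveLatticeGap →
        Summit.QuantumFields.QCD.Theses.GradientFlowSpecies.GapTransfer →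
          Summit.QuantumFields.QCD.Theses.WilsonQuarkChessboard.MassiveBridge :=
  fun hUV hL hGT =>
    massiveBridge_of_dynamicalQuarkContinuum_massiveLatticeGap_gapTransfer (fun _ => hUV) hL hGT

end Summit.QuantumFields.QCD.Theorems

end
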